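import Mathlib
import HarnessLib
import Summits.Ventures.LatticeQCDFlow.Scoring.GaussianStudentEventReduction

/-!
# THE UNEQUAL-COUNT TWO-ARM (WELCH-TYPE) EVENT AS A GAUSSIAN SCALE MIXTURE:
# `(N^{⊗a} ⊗ N^{⊗b}){(αḡ − βh̄)² ≤ t²(α²s²(g)/a + β²s²(h)/b)} = E ψ_t(λV₁ + λ'V₂)`

HONEST FRAMING: exact (Metropolis-corrected) sampling algorithms for lattice gauge theory;
figures of merit are autocorrelation/cost numbers at stated couplings and volumes; no
continuum-physics claim.

Venture `LatticeQCDFlow` (cell pub-lqcd), topic `Scoring`; FANOUT row 4 (`s0-u1-b`, GEN-33).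
NEW WORK of the cell (classical; not in Mathlib), no definition, nothing cited as a fact (Welch's
statistic / the Behrens–Fisher problem are NAMED ONLY).

WHY (row 4).  Row 4's acceptance sentence "A vs B within `t·σ_comb`, `σ_comb = √(SE_A² + SE_B²)`"
with a FIXED number of batches per arm has a Student-ratio limit when both arms carry the same
number `a` of batches and the same asymptotic variance (GEN-32 `BatchMeansTwoChainFixedBatchCount`;
`Scoring/GaussianStudentEventReduction` §3: exactly `2a − 2` squares).  With UNEQUAL counts `a ≠ b`
or unequal variances (different batch lengths, different samplers) the limit event is the
Welch-type event `{(αḡ − βh̄)² ≤ t²(α² s²(g)/a + β² s²(h)/b)}` under `N(0,1)^{⊗a} ⊗ N(0,1)^{⊗b}`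
(`α, β` the two asymptotic standard deviations), whose probability is NOT a Student-ratio
probability (Behrens–Fisher).  This file reduces it to a ONE-dimensional scale mixture: with
`τ² = α²/a + β²/b`, `λ = (α²/a)/τ²`, `λ' = (β²/b)/τ²`, it equals `∫ ψ_t(λV₁(w) + λ'V₂(w)) dN^{⊗(Fin n ⊕ Fin m)}(w)`,
`V₁, V₂` the means of the `n = a − 1` and `m = b − 1` squared tail coordinates,
`ψ_t(x) = N(0,1)([−t√x, t√x])` (`Scoring/GaussianStudentScaleMixture`).  The bounds that follow
(`λL_a + λ'L_b ≤ W ≤ N(0,1)([−t,t])`, Hsu's conservative `min(a,b) − 1` rule) are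
`Scoring/GaussianWelchBounds`.  Proof: Helmert on each arm (`measurePreserving_helmert_pi`,
`helmert_head_tail`), then on ONE product Gaussian over `Fin a ⊕ Fin b` the pair
`((α x_{inl 0}/√a − β x_{inr 0}/√b)/τ, tails)` has law `N(0,1) ⊗ N(0,1)^{⊗(Fin n ⊕ Fin m)}`
(`iIndepFun_pi`, `iIndepFun.indepFun_finset`, `gaussianReal_add_gaussianReal_of_indepFun`,
`gaussianReal_mul_const` / `_div_const`), and the numerator is integrated out first
(`Measure.prod_apply_symm`).

## Content

* **`pi_sum_gaussianReal_map_welchHead_tails`** (§1) — the joint law `N(0,1) ⊗ N(0,1)^{⊗(Fin n ⊕ Fin m)}`.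
* **`pi_gaussianReal_welch_real_eq_integral`** (§2) — the scale-mixture representation (`t ≥ 0`,
  `τ² > 0`, any `n, m`).

Depends on `Scoring/GaussianStudentEventReduction` (row 4 GEN-33) and Mathlib.  [ours] throughout.
-/

open MeasureTheory ProbabilityTheory Filter Topology Finset
namespace Summit.Ventures.LatticeQCDFlow.Scoring

open Set WithLp

/-! ## §1 The joint law behind the unequal-count two-arm reduction -/

section JointLaw

/-- **Welch head and tails.**  On ONE product Gaussian `N(0,1)^{⊗(Fin (n+1) ⊕ Fin (m+1))}` (arm A =
`inl` with `a = n + 1` coordinates, arm B = `inr` with `b = m + 1`), for weights `α, β` with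
`τ² = α²/a + β²/b > 0`, the pair `(U, V) = ((α x_{inl 0}/√a − β x_{inr 0}/√b)/τ, tails)` has law
`N(0,1) ⊗ N(0,1)^{⊗(Fin n ⊕ Fin m)}`: `U` is EXACTLY standard normal and independent of the
`n + m` remaining coordinates. [ours] -/
theorem pi_sum_gaussianReal_map_welchHead_tails (n m : ℕ) {α β : ℝ}
    (hτ : 0 < α ^ 2 / ((n + 1 : ℕ) : ℝ) + β ^ 2 / ((m + 1 : ℕ) : ℝ)) :
    (Measure.pi fun _ : Fin (n + 1) ⊕ Fin (m + 1) => gaussianReal 0 1).map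
        (fun x : Fin (n + 1) ⊕ Fin (m + 1) → ℝ =>
          ((α * x (Sum.inl 0) / Real.sqrt ((n + 1 : ℕ) : ℝ)
              - β * x (Sum.inr 0) / Real.sqrt ((m + 1 : ℕ) : ℝ))
            / Real.sqrt (α ^ 2 / ((n + 1 : ℕ) : ℝ) + β ^ 2 / ((m + 1 : ℕ) : ℝ)),
            fun s : Fin n ⊕ Fin m => x (Sum.map Fin.succ Fin.succ s)))
      = (gaussianReal 0 1).prod (Measure.pi fun _ : Fin n ⊕ Fin m => gaussianReal 0 1) := by
  set π' := Measure.pi fun _ : Fin (n + 1) ⊕ Fin (m + 1) => gaussianReal 0 1 with hπ'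
  set a : ℝ := ((n + 1 : ℕ) : ℝ) with ha'
  set b : ℝ := ((m + 1 : ℕ) : ℝ) with hb'
  have ha : 0 < a := by rw [ha']; positivity
  have hb : 0 < b := by rw [hb']; positivity
  set τ2 : ℝ := α ^ 2 / a + β ^ 2 / b with hτ2
  set ιe : Fin n ⊕ Fin m → Fin (n + 1) ⊕ Fin (m + 1) := Sum.map Fin.succ Fin.succ with hιe
  -- all coordinates are independent standard normals
  have hI : iIndepFun (fun (i : Fin (n + 1) ⊕ Fin (m + 1)) (x : Fin (n + 1) ⊕ Fin (m + 1) → ℝ) => x i) π' :=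
    iIndepFun_pi (X := fun _ x => x) fun _ => aemeasurable_id
  have hev : ∀ i : Fin (n + 1) ⊕ Fin (m + 1),
      HasLaw (fun x : Fin (n + 1) ⊕ Fin (m + 1) → ℝ => x i) (gaussianReal 0 1) π' := fun i =>
    (measurePreserving_eval (fun _ : Fin (n + 1) ⊕ Fin (m + 1) => gaussianReal 0 1) i).hasLaw
  -- the numerator `U`
  have hA := gaussianReal_mul_const (hev (Sum.inl 0)) (α / Real.sqrt a)
  have hB := gaussianReal_mul_const (hev (Sum.inr 0)) (β / Real.sqrt b)
  have hind : IndepFun (fun x : Fin (n + 1) ⊕ Fin (m + 1) → ℝ => x (Sum.inl 0) * (α / Real.sqrt a))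
      (-(fun x : Fin (n + 1) ⊕ Fin (m + 1) → ℝ => x (Sum.inr 0) * (β / Real.sqrt b))) π' :=
    ((hI.indepFun (by simp : (Sum.inl 0 : Fin (n + 1) ⊕ Fin (m + 1)) ≠ Sum.inr 0)).comp
      (measurable_id.mul_const _) (measurable_id.mul_const _)).comp measurable_id measurable_neg
  have hsum := gaussianReal_add_gaussianReal_of_indepFun hind hA.map_eq (gaussianReal_neg hB).map_eq
  have hD : HasLaw (fun x : Fin (n + 1) ⊕ Fin (m + 1) → ℝ =>
      α * x (Sum.inl 0) / Real.sqrt a - β * x (Sum.inr 0) / Real.sqrt b)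
      (gaussianReal 0 (NNReal.mk ((α / Real.sqrt a) ^ 2) (sq_nonneg _) * 1
        + NNReal.mk ((β / Real.sqrt b) ^ 2) (sq_nonneg _) * 1)) π' := by
    refine ⟨by fun_prop, ?_⟩
    have hfun : (fun x : Fin (n + 1) ⊕ Fin (m + 1) → ℝ =>
        α * x (Sum.inl 0) / Real.sqrt a - β * x (Sum.inr 0) / Real.sqrt b)
        = (fun x : Fin (n + 1) ⊕ Fin (m + 1) → ℝ => x (Sum.inl 0) * (α / Real.sqrt a))
          + -(fun x : Fin (n + 1) ⊕ Fin (m + 1) → ℝ => x (Sum.inr 0) * (β / Real.sqrt b)) := by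
      funext x
      simp only [Pi.add_apply, Pi.neg_apply]
      ring
    rw [hfun, hsum]
    simp
  have hU : HasLaw (fun x : Fin (n + 1) ⊕ Fin (m + 1) → ℝ =>
      (α * x (Sum.inl 0) / Real.sqrt a - β * x (Sum.inr 0) / Real.sqrt b) / Real.sqrt τ2)
      (gaussianReal 0 1) π' := by
    have h := gaussianReal_div_const hD (Real.sqrt τ2)
    rw [zero_div] at h
    convert h using 2
    apply NNReal.eq
    simp only [NNReal.coe_div, NNReal.coe_add, NNReal.coe_mk, NNReal.coe_one, mul_one]
    rw [div_pow, div_pow, Real.sq_sqrt ha.le, Real.sq_sqrt hb.le, Real.sq_sqrt hτ.le, ← hτ2,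
      div_self hτ.ne']
  -- the other coordinates `V`
  have hιe_inj : Function.Injective ιe :=
    Sum.map_injective.2 ⟨Fin.succ_injective _, Fin.succ_injective _⟩
  have hV : HasLaw (fun (x : Fin (n + 1) ⊕ Fin (m + 1) → ℝ) (s : Fin n ⊕ Fin m) => x (ιe s))
      (Measure.pi fun _ : Fin n ⊕ Fin m => gaussianReal 0 1) π' := by
    have hind' : iIndepFun (fun (s : Fin n ⊕ Fin m) (x : Fin (n + 1) ⊕ Fin (m + 1) → ℝ) => x (ιe s)) π' :=
      hI.precomp hιe_inj
    have hmeas : ∀ s : Fin n ⊕ Fin m,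
        AEMeasurable (fun x : Fin (n + 1) ⊕ Fin (m + 1) → ℝ => x (ιe s)) π' := fun s =>
      (measurable_pi_apply _).aemeasurable
    refine ⟨(measurable_pi_lambda _ fun s => measurable_pi_apply _).aemeasurable, ?_⟩
    rw [(iIndepFun_iff_map_fun_eq_pi_map hmeas).1 hind']
    congr 1
    funext s
    exact (hev (ιe s)).map_eq
  -- independence of `U` and `V`: disjoint coordinate sets
  have hUV : IndepFun (fun x : Fin (n + 1) ⊕ Fin (m + 1) → ℝ =>
        (α * x (Sum.inl 0) / Real.sqrt a - β * x (Sum.inr 0) / Real.sqrt b) / Real.sqrt τ2)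
      (fun (x : Fin (n + 1) ⊕ Fin (m + 1) → ℝ) (s : Fin n ⊕ Fin m) => x (ιe s)) π' := by
    classical
    set S : Finset (Fin (n + 1) ⊕ Fin (m + 1)) := {Sum.inl 0, Sum.inr 0} with hS
    set T : Finset (Fin (n + 1) ⊕ Fin (m + 1)) := Finset.univ.image ιe with hT
    have hST : Disjoint S T := by
      rw [Finset.disjoint_left]
      intro i hi hiT
      rcases Finset.mem_image.1 hiT with ⟨s, -, rfl⟩
      simp only [hS, Finset.mem_insert, Finset.mem_singleton] at hi
      rcases s with j | j
      · simp [hιe] at hi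
      · simp [hιe] at hi
    have hfin := hI.indepFun_finset S T hST fun i => measurable_pi_apply i
    have h0S : Sum.inl 0 ∈ S := by simp [hS]
    have h1S : Sum.inr 0 ∈ S := by simp [hS]
    have hkT : ∀ s, ιe s ∈ T := fun s => Finset.mem_image_of_mem _ (Finset.mem_univ s)
    have hgU : Measurable fun y : S → ℝ =>
        (α * y ⟨Sum.inl 0, h0S⟩ / Real.sqrt a - β * y ⟨Sum.inr 0, h1S⟩ / Real.sqrt b) / Real.sqrt τ2 := by
      have h1 : Measurable fun y : S → ℝ => y ⟨Sum.inl 0, h0S⟩ := measurable_pi_apply _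
      have h2 : Measurable fun y : S → ℝ => y ⟨Sum.inr 0, h1S⟩ := measurable_pi_apply _
      fun_prop
    have hgV : Measurable fun (y : T → ℝ) (s : Fin n ⊕ Fin m) => y ⟨ιe s, hkT s⟩ :=
      measurable_pi_lambda _ fun s => measurable_pi_apply _
    exact hfin.comp hgU hgV
  rw [(indepFun_iff_map_prod_eq_prod_map_map hU.aemeasurable hV.aemeasurable).1 hUV, hU.map_eq,
    hV.map_eq]

end JointLaw


/-! ## §2 The unequal-count two-arm event `{(α ḡ − β h̄)² ≤ t²(α² s²(g)/a + β² s²(h)/b)}` is a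
## scale mixture: `E ψ_t(λ V₁ + (1−λ) V₂)` -/

section Representation

/-- **Scale-mixture representation of the unequal-count two-arm (Welch-type) event.**  For arms of
`a = n + 1` and `b = m + 1` standard normal coordinates, weights `α, β` with `τ² = α²/a + β²/b > 0`
and `t ≥ 0`:
`(N^{⊗a} ⊗ N^{⊗b}){(g,h) | (α ḡ − β h̄)² ≤ t²(α² s²(g)/a + β² s²(h)/b)}
   = ∫ ψ_t(λ V₁(w) + λ' V₂(w)) dN(0,1)^{⊗(Fin n ⊕ Fin m)}(w)`,
`λ = (α²/a)/τ²`, `λ' = (β²/b)/τ²`, `V₁(w) = (Σ_j w_{inl j}²)/n`, `V₂(w) = (Σ_j w_{inr j}²)/m`,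
`ψ_t(x) = N(0,1)([−t√x, t√x])`. [ours] -/
theorem pi_gaussianReal_welch_real_eq_integral {t : ℝ} (ht : 0 ≤ t) (n m : ℕ)
    {α β : ℝ} (hτ : 0 < α ^ 2 / ((n + 1 : ℕ) : ℝ) + β ^ 2 / ((m + 1 : ℕ) : ℝ)) :
    (((Measure.pi fun _ : Fin (n + 1) => gaussianReal 0 1).prod
        (Measure.pi fun _ : Fin (m + 1) => gaussianReal 0 1))
      {p : (Fin (n + 1) → ℝ) × (Fin (m + 1) → ℝ) |
        (α * ((∑ i, p.1 i) / ((n + 1 : ℕ) : ℝ)) - β * ((∑ i, p.2 i) / ((m + 1 : ℕ) : ℝ))) ^ 2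
          ≤ t ^ 2 * (α ^ 2 * (((∑ j, (p.1 j - (∑ i, p.1 i) / ((n + 1 : ℕ) : ℝ)) ^ 2)
                / (((n + 1 : ℕ) : ℝ) - 1)) / ((n + 1 : ℕ) : ℝ))
            + β ^ 2 * (((∑ j, (p.2 j - (∑ i, p.2 i) / ((m + 1 : ℕ) : ℝ)) ^ 2)
                / (((m + 1 : ℕ) : ℝ) - 1)) / ((m + 1 : ℕ) : ℝ)))}).toReal
      = ∫ w, (gaussianReal 0 1).real (Icc
          (-(t * Real.sqrt ((α ^ 2 / ((n + 1 : ℕ) : ℝ)) / (α ^ 2 / ((n + 1 : ℕ) : ℝ) + β ^ 2 / ((m + 1 : ℕ) : ℝ))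
              * ((∑ j : Fin n, w (Sum.inl j) ^ 2) / (n : ℝ))
            + (β ^ 2 / ((m + 1 : ℕ) : ℝ)) / (α ^ 2 / ((n + 1 : ℕ) : ℝ) + β ^ 2 / ((m + 1 : ℕ) : ℝ))
              * ((∑ j : Fin m, w (Sum.inr j) ^ 2) / (m : ℝ)))))
          (t * Real.sqrt ((α ^ 2 / ((n + 1 : ℕ) : ℝ)) / (α ^ 2 / ((n + 1 : ℕ) : ℝ) + β ^ 2 / ((m + 1 : ℕ) : ℝ))
              * ((∑ j : Fin n, w (Sum.inl j) ^ 2) / (n : ℝ))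
            + (β ^ 2 / ((m + 1 : ℕ) : ℝ)) / (α ^ 2 / ((n + 1 : ℕ) : ℝ) + β ^ 2 / ((m + 1 : ℕ) : ℝ))
              * ((∑ j : Fin m, w (Sum.inr j) ^ 2) / (m : ℝ)))))
        ∂(Measure.pi fun _ : Fin n ⊕ Fin m => gaussianReal 0 1) := by
  set γ : Measure ℝ := gaussianReal 0 1 with hγ
  set a : ℝ := ((n + 1 : ℕ) : ℝ) with ha'
  set b : ℝ := ((m + 1 : ℕ) : ℝ) with hb'
  have ha : 0 < a := by rw [ha']; positivity
  have hb : 0 < b := by rw [hb']; positivity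
  set τ2 : ℝ := α ^ 2 / a + β ^ 2 / b with hτ2
  set la : ℝ := (α ^ 2 / a) / τ2 with hla
  set lb : ℝ := (β ^ 2 / b) / τ2 with hlb
  have hla0 : 0 ≤ la := div_nonneg (div_nonneg (sq_nonneg _) ha.le) hτ.le
  have hlb0 : 0 ≤ lb := div_nonneg (div_nonneg (sq_nonneg _) hb.le) hτ.le
  set πa := Measure.pi fun _ : Fin (n + 1) => γ with hπa
  set πb := Measure.pi fun _ : Fin (m + 1) => γ with hπb
  -- Helmert on each arm
  set Oa := ((ℝ ∙ ((toLp 2 (fun _ : Fin (n + 1) => (Real.sqrt (Fintype.card (Fin (n + 1))))⁻¹)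
      : EuclideanSpace ℝ (Fin (n + 1))) - EuclideanSpace.single 0 (1 : ℝ)))ᗮ).reflection with hOa
  set Ob := ((ℝ ∙ ((toLp 2 (fun _ : Fin (m + 1) => (Real.sqrt (Fintype.card (Fin (m + 1))))⁻¹)
      : EuclideanSpace ℝ (Fin (m + 1))) - EuclideanSpace.single 0 (1 : ℝ)))ᗮ).reflection with hOb
  set Ψa : (Fin (n + 1) → ℝ) → (Fin (n + 1) → ℝ) := fun z => ofLp (Oa (toLp 2 z)) with hΨa
  set Ψb : (Fin (m + 1) → ℝ) → (Fin (m + 1) → ℝ) := fun z => ofLp (Ob (toLp 2 z)) with hΨb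
  have hΨa_mp : MeasurePreserving Ψa πa πa := by
    have := measurePreserving_helmert_pi (ι := Fin (n + 1)) 0
    rwa [← hOa] at this
  have hΨb_mp : MeasurePreserving Ψb πb πb := by
    have := measurePreserving_helmert_pi (ι := Fin (m + 1)) 0
    rwa [← hOb] at this
  obtain ⟨hheadA, htailA⟩ := helmert_head_tail n
  obtain ⟨hheadB, htailB⟩ := helmert_head_tail m
  rw [← hOa] at hheadA htailA
  rw [← hOb] at hheadB htailB
  have ha1 : a - 1 = (n : ℝ) := by rw [ha']; push_cast; ring
  have hb1 : b - 1 = (m : ℝ) := by rw [hb']; push_cast; ring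
  -- Step 1: the event is the preimage under `Ψa × Ψb` of the head/tails event
  set E' : Set ((Fin (n + 1) → ℝ) × (Fin (m + 1) → ℝ)) := {p |
    |(α * p.1 0 / Real.sqrt a - β * p.2 0 / Real.sqrt b) / Real.sqrt τ2|
      ≤ t * Real.sqrt (la * ((∑ j : Fin n, p.1 j.succ ^ 2) / (n : ℝ))
        + lb * ((∑ j : Fin m, p.2 j.succ ^ 2) / (m : ℝ)))} with hE'
  have hE'm : MeasurableSet E' := measurableSet_le (by fun_prop) (by fun_prop)
  have hpre : {p : (Fin (n + 1) → ℝ) × (Fin (m + 1) → ℝ) |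
        (α * ((∑ i, p.1 i) / a) - β * ((∑ i, p.2 i) / b)) ^ 2
          ≤ t ^ 2 * (α ^ 2 * (((∑ j, (p.1 j - (∑ i, p.1 i) / a) ^ 2) / (a - 1)) / a)
            + β ^ 2 * (((∑ j, (p.2 j - (∑ i, p.2 i) / b) ^ 2) / (b - 1)) / b))}
      = (Prod.map Ψa Ψb) ⁻¹' E' := by
    ext p
    simp only [Set.mem_setOf_eq, Set.mem_preimage, hE', Prod.map_fst, Prod.map_snd]
    rw [show Ψa p.1 0 = _ from hheadA p.1, show Ψb p.2 0 = _ from hheadB p.2,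
      show ∑ j : Fin n, Ψa p.1 j.succ ^ 2 = _ from htailA p.1,
      show ∑ j : Fin m, Ψb p.2 j.succ ^ 2 = _ from htailB p.2, ha1, hb1]
    set Sg := ∑ i, p.1 i
    set Sh := ∑ i, p.2 i
    set Rg := ∑ j, (p.1 j - Sg / a) ^ 2
    set Rh := ∑ j, (p.2 j - Sh / b) ^ 2
    have hRg : 0 ≤ Rg := Finset.sum_nonneg fun j _ => sq_nonneg _
    have hRh : 0 ≤ Rh := Finset.sum_nonneg fun j _ => sq_nonneg _
    have hM : 0 ≤ la * (Rg / (n : ℝ)) + lb * (Rh / (m : ℝ)) := by positivity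
    rw [abs_le_mul_sqrt_iff_sq_le ht hM]
    have hsa : Real.sqrt a ≠ 0 := (Real.sqrt_pos.2 ha).ne'
    have hsb : Real.sqrt b ≠ 0 := (Real.sqrt_pos.2 hb).ne'
    have e1 : α * (Sg / Real.sqrt a) / Real.sqrt a = α * (Sg / a) := by
      rw [mul_div_assoc, div_div, Real.mul_self_sqrt ha.le]
    have e2 : β * (Sh / Real.sqrt b) / Real.sqrt b = β * (Sh / b) := by
      rw [mul_div_assoc, div_div, Real.mul_self_sqrt hb.le]
    rw [e1, e2, div_pow, Real.sq_sqrt hτ.le]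
    set X := Rg / (n : ℝ)
    set Y := Rh / (m : ℝ)
    have key2 : t ^ 2 * (la * X + lb * Y) = (t ^ 2 * (α ^ 2 * (X / a) + β ^ 2 * (Y / b))) / τ2 := by
      simp only [hla, hlb]
      field_simp
    rw [key2, div_le_div_iff_of_pos_right hτ]
  rw [show {p : (Fin (n + 1) → ℝ) × (Fin (m + 1) → ℝ) |
        (α * ((∑ i, p.1 i) / ((n + 1 : ℕ) : ℝ)) - β * ((∑ i, p.2 i) / ((m + 1 : ℕ) : ℝ))) ^ 2
          ≤ t ^ 2 * (α ^ 2 * (((∑ j, (p.1 j - (∑ i, p.1 i) / ((n + 1 : ℕ) : ℝ)) ^ 2)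
                / (((n + 1 : ℕ) : ℝ) - 1)) / ((n + 1 : ℕ) : ℝ))
            + β ^ 2 * (((∑ j, (p.2 j - (∑ i, p.2 i) / ((m + 1 : ℕ) : ℝ)) ^ 2)
                / (((m + 1 : ℕ) : ℝ) - 1)) / ((m + 1 : ℕ) : ℝ)))} = (Prod.map Ψa Ψb) ⁻¹' E' from hpre,
    ← Measure.map_apply (hΨa_mp.measurable.prodMap hΨb_mp.measurable) hE'm,
    (hΨa_mp.prod hΨb_mp).map_eq]
  -- Step 2: ONE product Gaussian over `Fin (n+1) ⊕ Fin (m+1)`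
  set π' := Measure.pi fun _ : Fin (n + 1) ⊕ Fin (m + 1) => γ with hπ'
  have hσ : MeasurePreserving (MeasurableEquiv.sumPiEquivProdPi fun _ : Fin (n + 1) ⊕ Fin (m + 1) => ℝ)
      π' (πa.prod πb) := measurePreserving_sumPiEquivProdPi fun _ : Fin (n + 1) ⊕ Fin (m + 1) => γ
  rw [← hσ.map_eq, Measure.map_apply (MeasurableEquiv.measurable _) hE'm]
  -- Step 3: the pulled-back event is `(U, V) ⁻¹' B`
  set UV : (Fin (n + 1) ⊕ Fin (m + 1) → ℝ) → ℝ × (Fin n ⊕ Fin m → ℝ) := fun x =>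
    ((α * x (Sum.inl 0) / Real.sqrt a - β * x (Sum.inr 0) / Real.sqrt b) / Real.sqrt τ2,
      fun s : Fin n ⊕ Fin m => x (Sum.map Fin.succ Fin.succ s)) with hUV
  set M : (Fin n ⊕ Fin m → ℝ) → ℝ := fun v =>
    la * ((∑ j : Fin n, v (Sum.inl j) ^ 2) / (n : ℝ)) + lb * ((∑ j : Fin m, v (Sum.inr j) ^ 2) / (m : ℝ))
    with hM
  have hMm : Measurable M := by simp only [hM]; fun_prop
  set B : Set (ℝ × (Fin n ⊕ Fin m → ℝ)) := {q | |q.1| ≤ t * Real.sqrt (M q.2)} with hB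
  have hBm : MeasurableSet B :=
    measurableSet_le (by fun_prop) (measurable_const.mul (hMm.comp measurable_snd).sqrt)
  have hUVm : Measurable UV := by fun_prop
  have hpre2 : (MeasurableEquiv.sumPiEquivProdPi fun _ : Fin (n + 1) ⊕ Fin (m + 1) => ℝ) ⁻¹' E'
      = UV ⁻¹' B := by
    ext x
    simp only [hE', hB, hUV, hM, Set.mem_preimage, Set.mem_setOf_eq,
      MeasurableEquiv.coe_sumPiEquivProdPi, Equiv.sumPiEquivProdPi, Equiv.coe_fn_mk, Sum.map_inl,
      Sum.map_inr]
  rw [hpre2, ← Measure.map_apply hUVm hBm, hUV, pi_sum_gaussianReal_map_welchHead_tails n m hτ,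
    Measure.prod_apply_symm hBm]
  -- Step 4: integrate out the standard normal numerator first
  have hsec : ∀ v : Fin n ⊕ Fin m → ℝ, (fun u : ℝ => (u, v)) ⁻¹' B
      = Icc (-(t * Real.sqrt (M v))) (t * Real.sqrt (M v)) := fun v => by
    ext u; simp [hB, abs_le]
  have hmeas : Measurable fun v : Fin n ⊕ Fin m → ℝ => γ ((fun u : ℝ => (u, v)) ⁻¹' B) :=
    measurable_measure_prodMk_right hBm
  rw [← integral_toReal hmeas.aemeasurable (ae_of_all _ fun v => measure_lt_top _ _)]
  refine integral_congr_ae (ae_of_all _ fun v => ?_)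
  simp only [hsec v, measureReal_def, hM]

end Representation

end Summit.Ventures.LatticeQCDFlow.Scoring
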